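import Mathlib
import Summits.ValiantsHypothesis.ValiantsHypothesis.Theorems.FifoMatchingNNDivisionHardPolylogArcFaces
import HarnessLib

/-!
# Route FifoMatching — crux `NNDivisionHard` (stmt-ValiantsHypothesis-21181): IRRELEVANT DIRECTIONS ARE FREE — the Newton
# dimension is read on a fibre over the variables `NN_n` does not use (junk pairs `(j, i)`, `j ≥ i`; unusable long arcs)

The cofactor `h ∈ ℝ≥0[Fin 2n × Fin 2n]` may use variables that `NN_n` never uses — the "junk" pairs `(j, i)` with `j ≥ i`
(only `(i, M i)` with `i < M i` occur in an arc monomial) and, more generally, any `e ∉ vars NN_n`.  Such coordinates inflate the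
Newton dimension of `h` without bearing on the certificate.  They are removed for free: a weight `w` vanishing on `vars NN_n` has
`top_w NN_n = NN_n` (`topComponent_eq_self_of_vars`), so `(top_w h, NN_n · top_w h)` is again a certificate, and `top_w h` is
ONE FIBRE of `h` over a `w`-extreme point of its projection to the irrelevant coordinates:

* `topComponent_eq_self_of_vars` — `(∀ e ∈ vars p, w e = 0) ⇒ top_w p = p`;
* `fst_lt_snd_of_mem_vars_nestFreeMatchingPoly` — every variable `e` of `NN_n` has `e.1 < e.2`;
* ★★ `irrelevantFibre_not_certificate_qp'` — **for every `c` there are `k, n₀`: for all `n ≥ n₀`, every weight `w` vanishing on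
  `vars NN_n` and every `h ≠ 0` with `(dim Newt(top_w h) + 1)(log₂ n)^k ≤ n`: `2^((log₂ n + c)^c) < L₊(NN_n · h) + L₊(h)`;**
  ★ `junkFibre_not_certificate_qp'` — the instance `w` supported on the junk pairs `{(j, i) : ¬ j < i}`.

HONEST FRAMING: loophole book-keeping for ONE rung of ONE crux; stmt-21181 stays OPEN; nothing here bears on `NNNotVP` or on
VP ≠ VNP (NOT proved).  No definitions, no named facts.  References: Bürgisser 2000 Rem. 2.7 [Burgisser2000];
Hrubeš–Yehudayoff 2021 §6 Problem 2 [HrubesYehudayoff2021].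
-/

noncomputable section

-- Sub = Summit single-conjunct layout: the duplicated namespace component is mandated by the tree.
set_option linter.dupNamespace false
set_option autoImplicit false

namespace Summit.ValiantsHypothesis.ValiantsHypothesis.Theorems.FifoMatching.NNDivisionHard.IrrelevantDirections

open Finset MvPolynomial Literature.Computability.AlgebraicComplexity
open Summit.ValiantsHypothesis.ValiantsHypothesis.Theorems.ZeroOneTransfer.Negative
  (topComponent topComponent_mul complexity_topComponent_le topComponent_ne_zero coeff_topComponent)
open Summit.ValiantsHypothesis.ValiantsHypothesis.Theorems.FifoMatching.NNDivisionHard.PolylogArcFaces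
  (polylogNewtonDim_not_certificate_qp')
open scoped NNReal BigOperators

/-! ### §1 Weights vanishing on the variables of a polynomial -/

section Free

variable {σ : Type*}

/-- If `w` vanishes on every variable of `p`, then every monomial of `p` has `w`-weight `0` and `top_w p = p`. [folklore] -/
theorem topComponent_eq_self_of_vars [DecidableEq σ] (w : σ → ℕ) (p : MvPolynomial σ ℝ≥0)
    (hw : ∀ e ∈ p.vars, w e = 0) : topComponent w p = p := by
  classical
  have hzero : ∀ d ∈ p.support, Finsupp.weight w d = 0 := by
    intro d hd
    rw [Finsupp.weight_apply, Finsupp.sum]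
    refine Finset.sum_eq_zero fun a ha => ?_
    have : w a = 0 := hw a ((mem_vars_iff_mem_support a).2 ⟨d, hd, ha⟩)
    simp [this]
  have hdeg : weightedTotalDegree w p = 0 := by
    apply le_antisymm _ (Nat.zero_le _)
    exact Finset.sup_le fun d hd => (hzero d hd).le
  refine MvPolynomial.ext _ _ fun d => ?_
  rw [coeff_topComponent, hdeg]
  split_ifs with h
  · rfl
  · by_contra hne
    exact h (hzero d (mem_support_iff.2 (Ne.symm hne)))

end Free

/-! ### §2 The variables of `NN_n` are proper arcs -/

variable {n : ℕ}

/-- Every variable of `NN_n` is a proper arc `(i, j)` with `i < j`. [folklore] -/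
theorem fst_lt_snd_of_mem_vars_nestFreeMatchingPoly {e : Fin (2 * n) × Fin (2 * n)}
    (he : e ∈ (nestFreeMatchingPoly n ℝ≥0).vars) : e.1 < e.2 := by
  classical
  obtain ⟨d, hd, hed⟩ := (mem_vars_iff_mem_support e).1 he
  rw [support_nestFreeMatchingPoly, Finset.mem_image] at hd
  obtain ⟨M, -, rfl⟩ := hd
  obtain ⟨i, j⟩ := e
  have h1 := Finsupp.mem_support_iff.1 hed
  rw [arcExponent_apply] at h1
  split_ifs at h1 with hc
  · rw [← hc.2]; exact hc.1
  · exact absurd rfl h1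

/-! ### §3 Fibres over irrelevant coordinates -/

/-- ★★ **IRRELEVANT DIRECTIONS ARE FREE.**  For every `c` there are `k, n₀` with: for all `n ≥ n₀`, every weight `w` vanishing
on `vars NN_n` and every `h ≠ 0` whose `w`-initial form has Newton dimension `D` with `(D + 1)(log₂ n)^k ≤ n`:
`2^((log₂ n + c)^c) < L₊(NN_n · h) + L₊(h)`. [cite: Burgisser2000, Rem. 2.7] [cite: HrubesYehudayoff2021, §6 Problem 2] -/
theorem irrelevantFibre_not_certificate_qp' (c : ℕ) : ∃ k n₀ : ℕ, ∀ n : ℕ, n₀ ≤ n →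
    ∀ (w : Fin (2 * n) × Fin (2 * n) → ℕ), (∀ e ∈ (nestFreeMatchingPoly n ℝ≥0).vars, w e = 0) →
    ∀ h : MvPolynomial (Fin (2 * n) × Fin (2 * n)) ℝ≥0, h ≠ 0 →
      (Module.finrank ℚ (vectorSpan ℚ ((fun u : (Fin (2 * n) × Fin (2 * n)) →₀ ℕ =>
        fun a : Fin (2 * n) × Fin (2 * n) => (u a : ℚ)) ''
          ((topComponent w h).support : Set ((Fin (2 * n) × Fin (2 * n)) →₀ ℕ)))) + 1) * (Nat.log 2 n) ^ k ≤ n →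
      2 ^ ((Nat.log 2 n + c) ^ c) < complexity (nestFreeMatchingPoly n ℝ≥0 * h) + complexity h := by
  classical
  obtain ⟨k, n₀, hk⟩ := polylogNewtonDim_not_certificate_qp' c
  refine ⟨k, n₀, fun n hn w hw h hh hD => ?_⟩
  have H := hk n hn (topComponent w h) (topComponent_ne_zero w hh) hD
  have hNN : topComponent w (nestFreeMatchingPoly n ℝ≥0) = nestFreeMatchingPoly n ℝ≥0 :=
    topComponent_eq_self_of_vars w _ hw
  have hprod : nestFreeMatchingPoly n ℝ≥0 * topComponent w h = topComponent w (nestFreeMatchingPoly n ℝ≥0 * h) := by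
    rw [topComponent_mul, hNN]
  have h1 : complexity (nestFreeMatchingPoly n ℝ≥0 * topComponent w h) ≤
      complexity (nestFreeMatchingPoly n ℝ≥0 * h) := by
    rw [hprod]
    exact complexity_topComponent_le w _
  have h2 : complexity (topComponent w h) ≤ complexity h := complexity_topComponent_le w h
  omega

/-- ★ **JUNK FIBRES**: the instance of a weight supported on the junk pairs `(j, i)`, `¬ j < i` (never variables of `NN_n`):
for every `c` there are `k, n₀` with: for all `n ≥ n₀`, every `w` with `w (i, j) = 0` whenever `i < j`, and every `h ≠ 0` with
`(dim Newt(top_w h) + 1)(log₂ n)^k ≤ n`: `2^((log₂ n + c)^c) < L₊(NN_n · h) + L₊(h)`. [cite: HrubesYehudayoff2021, §6 Problem 2] -/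
theorem junkFibre_not_certificate_qp' (c : ℕ) : ∃ k n₀ : ℕ, ∀ n : ℕ, n₀ ≤ n →
    ∀ (w : Fin (2 * n) × Fin (2 * n) → ℕ), (∀ e : Fin (2 * n) × Fin (2 * n), e.1 < e.2 → w e = 0) →
    ∀ h : MvPolynomial (Fin (2 * n) × Fin (2 * n)) ℝ≥0, h ≠ 0 →
      (Module.finrank ℚ (vectorSpan ℚ ((fun u : (Fin (2 * n) × Fin (2 * n)) →₀ ℕ =>
        fun a : Fin (2 * n) × Fin (2 * n) => (u a : ℚ)) ''
          ((topComponent w h).support : Set ((Fin (2 * n) × Fin (2 * n)) →₀ ℕ)))) + 1) * (Nat.log 2 n) ^ k ≤ n →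
      2 ^ ((Nat.log 2 n + c) ^ c) < complexity (nestFreeMatchingPoly n ℝ≥0 * h) + complexity h := by
  obtain ⟨k, n₀, hk⟩ := irrelevantFibre_not_certificate_qp' c
  exact ⟨k, n₀, fun n hn w hw h hh hD =>
    hk n hn w (fun e he => hw e (fst_lt_snd_of_mem_vars_nestFreeMatchingPoly he)) h hh hD⟩

end Summit.ValiantsHypothesis.ValiantsHypothesis.Theorems.FifoMatching.NNDivisionHard.IrrelevantDirections

end
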